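import Summits.Schanuel.Schanuel.Theorems.ZilberEacBranchPoleFibrePoints
import HarnessLib

/-!
# The exponential-polynomial regime, CVIII (a): the CHART `x₀ = 2πin − (L/k) log n + w` —
# bookkeeping lemmas for the perturbation theorem (file CVIII (b))

HONEST FRAMING.  Cell `pub-schanuel` (Zilber's Exponential-Algebraic Closedness, case ladder;
host summit Schanuel), seat 2, gen 34.  Infrastructure only: the chart of file XXXI
(`exists_poleFibre_expPoints`) isolated as lemmas — the label `q_n(w) = 1 + (a log n + w)/(2πin)`
is uniformly close to `1` on a ball (`norm_chartLabel_sub_one_le`, `eventually_chart_uniform`),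
and along `s = z^{-1} n^{-1/k} e^{-Log(q)/k}` one has `s^{-k} = 2πin + a log n + w` and
`e^{s^{-k}} s^{-L} = z^{L} e^{w} e^{(L/k) Log q}` (`chart_exp_mul_zpow_inv`, with `a = −L/k`);
plus three small uniformity lemmas for finite families of rows.  [folklore]; nothing here bears
on Mantova–Masser's question (OPEN), EC(3,2) (OPEN) or Schanuel's conjecture (neither used nor
implied); EAC ⇏ SC.
-/

noncomputable section

open Filter Topology Metric Complex

set_option linter.dupNamespace false

namespace Summit.Schanuel.Schanuel.Theorems

/-! ## Part A. Finite families of rows -/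

/-- A finite family of functions continuous at `0` is uniformly close to its values at `0` near `0`.
[folklore] -/
theorem exists_delta_rows_near_zero {α : ℕ → ℂ → ℂ} (d : ℕ) (hα : ∀ i, ContinuousAt (α i) 0)
    {ε : ℝ} (hε : 0 < ε) :
    ∃ δ > 0, ∀ σ : ℂ, ‖σ‖ < δ → ∀ i ∈ Finset.range (d + 1), ‖α i σ - α i 0‖ < ε := by
  have h : ∀ᶠ σ in 𝓝 (0 : ℂ), ∀ i ∈ Finset.range (d + 1), ‖α i σ - α i 0‖ < ε := by
    refine (Filter.eventually_all_finset _).2 fun i _ => ?_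
    obtain ⟨δ, hδ, h⟩ := (Metric.continuousAt_iff.1 (hα i)) ε hε
    refine Metric.eventually_nhds_iff.2 ⟨δ, hδ, fun σ hσ => ?_⟩
    rw [← dist_eq_norm]
    exact h hσ
  obtain ⟨δ, hδ, h⟩ := Metric.eventually_nhds_iff.1 h
  exact ⟨δ, hδ, fun σ hσ => h (by rwa [dist_zero_right])⟩

/-- A finite family of functions analytic at `0` is differentiable on a common ball around `0`.
[folklore] -/
theorem exists_ball_rows_differentiable {α : ℕ → ℂ → ℂ} (d : ℕ) (hα : ∀ i, AnalyticAt ℂ (α i) 0) :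
    ∃ ρ > 0, ∀ σ : ℂ, ‖σ‖ < ρ → ∀ i ∈ Finset.range (d + 1), DifferentiableAt ℂ (α i) σ := by
  have h : ∀ᶠ σ in 𝓝 (0 : ℂ), ∀ i ∈ Finset.range (d + 1), DifferentiableAt ℂ (α i) σ := by
    refine (Filter.eventually_all_finset _).2 fun i _ => ?_
    filter_upwards [(hα i).eventually_analyticAt] with σ hσ
    exact hσ.differentiableAt
  obtain ⟨ρ, hρ, h⟩ := Metric.eventually_nhds_iff.1 h
  exact ⟨ρ, hρ, fun σ hσ => h (by rwa [dist_zero_right])⟩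

/-- Termwise bound for a row sum: `‖Σ_{i ≤ d} c_i Y^i‖ ≤ (d+1)·η·R^d` when `‖c_i‖ ≤ η`, `‖Y‖ ≤ R`,
`1 ≤ R`. [folklore] -/
theorem norm_rowSum_le {c : ℕ → ℂ} {d : ℕ} {η R : ℝ} (hη : 0 ≤ η) (hR : 1 ≤ R)
    (hc : ∀ i ∈ Finset.range (d + 1), ‖c i‖ ≤ η) {Y : ℂ} (hY : ‖Y‖ ≤ R) :
    ‖∑ i ∈ Finset.range (d + 1), c i * Y ^ i‖ ≤ (d + 1) * η * R ^ d := by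
  calc ‖∑ i ∈ Finset.range (d + 1), c i * Y ^ i‖
      ≤ ∑ i ∈ Finset.range (d + 1), ‖c i * Y ^ i‖ := norm_sum_le _ _
    _ ≤ ∑ i ∈ Finset.range (d + 1), η * R ^ d := by
        refine Finset.sum_le_sum fun i hi => ?_
        rw [norm_mul, norm_pow]
        have hi' : i ≤ d := Nat.lt_succ_iff.1 (Finset.mem_range.1 hi)
        have h1 : ‖Y‖ ^ i ≤ R ^ i := pow_le_pow_left₀ (norm_nonneg _) hY i
        have h2 : R ^ i ≤ R ^ d := pow_le_pow_right₀ hR hi'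
        exact mul_le_mul (hc i hi) (h1.trans h2) (pow_nonneg (norm_nonneg _) _) hη
    _ = (d + 1) * η * R ^ d := by
        rw [Finset.sum_const, Finset.card_range, nsmul_eq_mul]
        push_cast
        ring

/-- `‖u‖ < 2` when `‖u − 1‖ < 1`. [folklore] -/
theorem norm_lt_two_of_norm_sub_one_lt {u : ℂ} {η : ℝ} (hu : ‖u - 1‖ < η) (hη : η ≤ 1) :
    ‖u‖ < 2 := by
  have := norm_le_norm_add_norm_sub' u 1
  rw [norm_one] at this
  linarith [hu.trans_le hη]

/-! ## Part B. The chart of file XXXI -/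

/-- **The label is close to `1`.**  For `n ≥ 1` and `w ∈ closedBall w₀ 2`:
`‖q_n(w) − 1‖ ≤ (‖a‖ log n + ‖w₀‖ + 2)/(2πn)`, `q_n(w) = 1 + (a log n + w)/(2πin)`. [folklore] -/
theorem norm_chartLabel_sub_one_le (a w₀ : ℂ) {n : ℕ} (hn : 1 ≤ n) {w : ℂ}
    (hw : w ∈ closedBall w₀ 2) :
    ‖(1 + (a * (Real.log n : ℂ) + w) / ((n : ℂ) * (2 * Real.pi * I))) - 1‖ ≤
      (‖a‖ * Real.log n + (‖w₀‖ + 2)) / (2 * Real.pi * n) := by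
  have hlog0 : 0 ≤ Real.log n := Real.log_nonneg (by exact_mod_cast hn)
  have hw' : ‖w‖ ≤ ‖w₀‖ + 2 := by
    have h1 := mem_closedBall.1 hw
    rw [dist_eq_norm] at h1
    have := norm_le_norm_add_norm_sub' w w₀
    linarith [norm_sub_rev w w₀]
  have hden : ‖(n : ℂ) * (2 * Real.pi * I)‖ = 2 * Real.pi * n := by
    rw [norm_mul, Complex.norm_natCast]
    simp [abs_of_pos Real.pi_pos]
    ring
  simp only [add_sub_cancel_left, norm_div, hden]
  refine div_le_div_of_nonneg_right ?_ (by positivity)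
  calc ‖a * (Real.log n : ℂ) + w‖ ≤ ‖a * (Real.log n : ℂ)‖ + ‖w‖ := norm_add_le _ _
    _ = ‖a‖ * Real.log n + ‖w‖ := by
        rw [norm_mul, Complex.norm_real, Real.norm_eq_abs, abs_of_nonneg hlog0]
    _ ≤ ‖a‖ * Real.log n + (‖w₀‖ + 2) := by linarith

/-- `e^{-log n / k} → 0` (`k ≥ 1`). [folklore] -/
theorem tendsto_exp_neg_log_div (k : ℕ) (hk : 1 ≤ k) :
    Tendsto (fun n : ℕ => Real.exp (-(Real.log n) / k)) atTop (𝓝 0) := by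
  have hl : Tendsto (fun n : ℕ => -(Real.log n) / k) atTop atBot := by
    have := (Real.tendsto_log_atTop.comp tendsto_natCast_atTop_atTop)
    have h' : Tendsto (fun n : ℕ => Real.log n / k) atTop atTop :=
      this.atTop_div_const (by exact_mod_cast hk)
    refine (tendsto_neg_atTop_atBot.comp h').congr fun n => ?_
    simp [neg_div]
  exact Real.tendsto_exp_atBot.comp hl

/-- **The uniform statement of the chart.**  For every `η > 0`, eventually in `n`: `n ≥ 1`,
`e^{-log n/k} < η`, and for all `w ∈ closedBall w₀ 2` the label `q_n(w)` lies in the slit plane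
with `‖e^{-Log(q)/k} − 1‖ < η` and `‖e^{b Log q} − 1‖ < η`. [folklore] -/
theorem eventually_chart_uniform (k : ℕ) (hk : 1 ≤ k) (a b w₀ : ℂ) {η : ℝ} (hη : 0 < η) :
    ∀ᶠ n : ℕ in atTop, 1 ≤ n ∧ Real.exp (-(Real.log n) / k) < η ∧ ∀ w ∈ closedBall w₀ 2,
      (1 + (a * (Real.log n : ℂ) + w) / ((n : ℂ) * (2 * Real.pi * I))) ∈ slitPlane ∧
      ‖Complex.exp (-(Complex.log (1 + (a * (Real.log n : ℂ) + w) / ((n : ℂ) * (2 * Real.pi * I))))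
          / k) - 1‖ < η ∧
      ‖Complex.exp (b * Complex.log (1 + (a * (Real.log n : ℂ) + w) / ((n : ℂ) * (2 * Real.pi * I))))
          - 1‖ < η := by
  obtain ⟨δ', hδ'0, hδ'q⟩ := exists_delta_log_powers_near_one k b hη
  filter_upwards [eventually_ge_atTop 1, (tendsto_order.1 (tendsto_log_label_div ‖a‖ (‖w₀‖ + 2))).2
    δ' hδ'0, (tendsto_order.1 (tendsto_exp_neg_log_div k hk)).2 η hη] with n hn hδn hEn
  refine ⟨hn, hEn, fun w hw => ?_⟩
  exact hδ'q _ ((norm_chartLabel_sub_one_le a w₀ hn hw).trans_lt hδn)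

/-- **The chart identity.**  With `a = −L/k`, `q = 1 + (a log n + w)/(2πin) ∈ slitPlane` and
`s = z^{-1} e^{-log n/k} e^{-Log(q)/k}` (`z^k = 2πi`, `n ≥ 1`): `s^{-k} = 2πin + a log n + w` and
`e^{s^{-k}} · s^{-L} = (z^{-1})^{-L} · e^{w} · e^{−a Log q}`. [folklore] -/
theorem chart_exp_mul_zpow_inv {k : ℕ} (hk : 1 ≤ k) {z : ℂ} (hz : z ^ k = 2 * Real.pi * I) (L : ℤ)
    {n : ℕ} (hn : 1 ≤ n) {q w : ℂ}
    (hq : q = 1 + ((-(L : ℂ) / k) * (Real.log n : ℂ) + w) / ((n : ℂ) * (2 * Real.pi * I)))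
    (hslit : q ∈ slitPlane) :
    ((z⁻¹ * Complex.exp (-(Real.log n : ℂ) / k) * Complex.exp (-(Complex.log q) / k)) ^ k)⁻¹ =
        (n : ℂ) * (2 * Real.pi * I) + ((-(L : ℂ) / k) * (Real.log n : ℂ) + w) ∧
    Complex.exp (((z⁻¹ * Complex.exp (-(Real.log n : ℂ) / k) *
        Complex.exp (-(Complex.log q) / k)) ^ k)⁻¹) *
      ((z⁻¹ * Complex.exp (-(Real.log n : ℂ) / k) * Complex.exp (-(Complex.log q) / k)) ^ L)⁻¹ =
      (z⁻¹ ^ L)⁻¹ * Complex.exp w * Complex.exp (-(-(L : ℂ) / k) * Complex.log q) := by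
  have hk0 : k ≠ 0 := by omega
  have hkC : (k : ℂ) ≠ 0 := Nat.cast_ne_zero.2 hk0
  have h2πI : (2 * Real.pi * I : ℂ) ≠ 0 := by simp [Real.pi_ne_zero, Complex.I_ne_zero]
  have hz0 : z ≠ 0 := by
    rintro rfl
    rw [zero_pow hk0] at hz
    exact h2πI hz.symm
  have hnC : (n : ℂ) ≠ 0 := Nat.cast_ne_zero.2 (by omega)
  have hq0 : q ≠ 0 := Complex.slitPlane_ne_zero hslit
  set a : ℂ := -(L : ℂ) / k with ha
  have hEk : Complex.exp (-(Real.log n : ℂ) / k) ^ k = ((n : ℂ))⁻¹ := by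
    rw [← Complex.exp_nat_mul, show (k : ℂ) * (-(Real.log n : ℂ) / k) = -(Real.log n : ℂ) by
      field_simp, Complex.exp_neg, ← Complex.ofReal_exp, Real.exp_log (by exact_mod_cast hn),
      Complex.ofReal_natCast]
  have hf1k : Complex.exp (-(Complex.log q) / k) ^ k = q⁻¹ := by
    rw [← Complex.exp_nat_mul, show (k : ℂ) * (-(Complex.log q) / k) = -(Complex.log q) by
      field_simp, Complex.exp_neg, Complex.exp_log hq0]
  have hsk : ((z⁻¹ * Complex.exp (-(Real.log n : ℂ) / k) * Complex.exp (-(Complex.log q) / k)) ^ k)⁻¹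
      = (n : ℂ) * (2 * Real.pi * I) + (a * (Real.log n : ℂ) + w) := by
    rw [mul_pow, mul_pow, inv_pow, hz, hEk, hf1k, hq]
    field_simp
  refine ⟨hsk, ?_⟩
  have hsL : (z⁻¹ * Complex.exp (-(Real.log n : ℂ) / k) * Complex.exp (-(Complex.log q) / k)) ^ L =
      z⁻¹ ^ L * Complex.exp (a * (Real.log n : ℂ)) * Complex.exp (a * Complex.log q) := by
    rw [mul_zpow, mul_zpow, ← Complex.exp_int_mul, ← Complex.exp_int_mul, ha]
    have e1 : ((L : ℤ) : ℂ) * (-(Real.log n : ℂ) / k) = -((L : ℤ) : ℂ) / k * (Real.log n : ℂ) := by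
      ring
    have e2 : ((L : ℤ) : ℂ) * (-(Complex.log q) / k) = -((L : ℤ) : ℂ) / k * Complex.log q := by ring
    rw [e1, e2]
  rw [hsk, Complex.exp_add, Complex.exp_nat_mul_two_pi_mul_I, one_mul, Complex.exp_add, hsL,
    neg_mul, Complex.exp_neg]
  have he0 : Complex.exp (a * (Real.log n : ℂ)) ≠ 0 := Complex.exp_ne_zero _
  have hf20 : Complex.exp (a * Complex.log q) ≠ 0 := Complex.exp_ne_zero _
  have hzL' : z⁻¹ ^ L ≠ 0 := zpow_ne_zero _ (inv_ne_zero hz0)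
  field_simp

end Summit.Schanuel.Schanuel.Theorems

end
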